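import Summits.FinalStateConjecture.FinalStateConjecture.Theorems.RobustClausewiseGenericityAssembly
import Literature.Geometry.Lorentzian.TameGenericity
import Literature.Geometry.Lorentzian.Genericity
import Literature.Geometry.Lorentzian.IsometryProofs
import HarnessLib

/-!
# A jointly smooth curve of data IMMERSED at `0` is injective on a window (registered stub
`stub_injOn_of_immersed`, line `Sketch` = tame template breathe ∘ trim ∘ kick, crux
`EIHFluxBalance.ModulatedKerrHandoff`, item stmt-FinalStateConjecture-17402)

Let `F : ℝ¹ → InitialDataSet (𝓡 3) X` be a jointly smooth one-parameter family
(`InitialDataSet.IsSmoothDataFamily`) which is immersed at `0` (`InitialDataSet.IsImmersedAtZero`).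
Applying immersion to the basis vector `e₀ ≠ 0` of `ℝ¹` gives a point `x`, tangent vectors `u, w` at
`x` and a scalar component `g c := h_{F c}(x)(u, w)` or `g c := k_{F c}(x)(u, w)` with
`dg(0) e₀ ≠ 0`. The component `g` is smooth: the section `c ↦ (x, h_{F c}(x))` (resp. `k`) of the
bundle of bilinear forms is read in the trivialisation of `TX` at `x` (`contMDiffAt_bilin_iff`,
`contMDiff_iff_contDiff`) and evaluated at the constant trivialised vectors. A `C¹` function with
non-zero derivative at `0` along `e₀` is injective on `{t e₀ : |t| < δ}`
(`RobustClausewiseGenericity.exists_injOn_line_of_fderiv_ne`, strict monotonicity of `t ↦ g (t e₀)`);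
since `c = c₀ e₀` and `‖c‖ = |c₀|` on `ℝ¹`, `F c = F c'` with `‖c‖, ‖c'‖ < δ` forces `g c = g c'`,
hence `c₀ = c'₀`, hence `c = c'`.

Template: the block `hF` of `Theorems/RobustClausewiseGenericityGaugeEnrichment` (smoothness of a
scalar component) and the injectivity step of
`RobustClausewiseGenericity.exists_localFamily_of_robustlyEscapable`. Mathlib + the Literature cone +
`Theorems/RobustClausewiseGenericityAssembly` only; no definitions, no named facts. Christodoulou,
CQG 16 (1999) A23, p. A24 (independent directions of a family); Lee, *Introduction to Smooth
Manifolds* (2013), Prop. 4.1 / Thm. 4.25 (immersions are locally injective).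
Stub-worker of the line lead prover-line-stmt-FinalStateConjecture-17402-0, 2026-08-17.
-/

-- the summit-side namespace `Summit.FinalStateConjecture.FinalStateConjecture.…` (summit = problem)
-- repeats a component by design, which the `dupNamespace` linter would flag on every decl.
set_option linter.dupNamespace false

noncomputable section

open scoped Manifold ContDiff Topology
open Bundle Filter Set Function TopologicalSpace Literature.Geometry.Lorentzian InitialDataSet

namespace Summit.FinalStateConjecture.FinalStateConjecture.Theorems.EIHFluxBalance.TameTemplate

variable {X : Type} [TopologicalSpace X] [ChartedSpace E3 X] [IsManifold (𝓡 3) ∞ X]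

/-- A scalar component `c ↦ s_c(v₀, w₀)` of a smooth family `c ↦ (x₀, s_c)` of bilinear forms on the
FIXED tangent space `T_{x₀} X` (a smooth map `ℝᵐ →` the bundle of bilinear forms on `TX` over the
constant base point `x₀`) is a smooth function of the parameter: read the section in the
trivialisation of `TX` at `x₀` (`contMDiffAt_bilin_iff`, `contMDiff_iff_contDiff`) and evaluate at the
(constant) trivialised vectors. Adapted from the block `hF` of
`Theorems/RobustClausewiseGenericityGaugeEnrichment`. -/
private theorem contDiff_bilin_apply_of_contMDiff_family {m : ℕ} (x₀ : X)
    {s : EuclideanSpace ℝ (Fin m) → (TangentSpace (𝓡 3) x₀ →L[ℝ] TangentSpace (𝓡 3) x₀ →L[ℝ] ℝ)}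
    (hs : ContMDiff 𝓘(ℝ, EuclideanSpace ℝ (Fin m)) ((𝓡 3).prod 𝓘(ℝ, E3 →L[ℝ] E3 →L[ℝ] ℝ)) ∞
      (fun c : EuclideanSpace ℝ (Fin m) ↦ TotalSpace.mk' (E3 →L[ℝ] E3 →L[ℝ] ℝ)
        (E := fun x : X ↦ TangentSpace (𝓡 3) x →L[ℝ] TangentSpace (𝓡 3) x →L[ℝ] ℝ) x₀ (s c)))
    (v₀ w₀ : TangentSpace (𝓡 3) x₀) :
    ContDiff ℝ ∞ (fun c : EuclideanSpace ℝ (Fin m) ↦ s c v₀ w₀) := by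
  set T := trivializationAt E3 (TangentSpace (𝓡 3) : X → Type _) x₀ with hT
  have h2 : ContMDiff 𝓘(ℝ, EuclideanSpace ℝ (Fin m)) 𝓘(ℝ, E3 →L[ℝ] E3 →L[ℝ] ℝ) ∞
      (fun c : EuclideanSpace ℝ (Fin m) ↦ (ContinuousLinearMap.precomp ℝ (T.symmL ℝ x₀)).comp
        ((s c).comp (T.symmL ℝ x₀))) := fun c ↦
    ((contMDiffAt_bilin_iff (IX := 𝓘(ℝ, EuclideanSpace ℝ (Fin m))) (IB := 𝓡 3)
      (V := (TangentSpace (𝓡 3) : X → Type _)) (b := fun _ : EuclideanSpace ℝ (Fin m) ↦ x₀)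
      (s := s) (x₀ := c)).1 (hs c)).2
  have h3 : ContDiff ℝ ∞ (fun c : EuclideanSpace ℝ (Fin m) ↦
      (ContinuousLinearMap.precomp ℝ (T.symmL ℝ x₀)).comp ((s c).comp (T.symmL ℝ x₀))) :=
    contMDiff_iff_contDiff.1 h2
  have hx₀T : x₀ ∈ T.baseSet := FiberBundle.mem_baseSet_trivializationAt' x₀
  set u : E3 := T.continuousLinearMapAt ℝ x₀ v₀ with hu
  set u' : E3 := T.continuousLinearMapAt ℝ x₀ w₀ with hu'
  have hsu : T.symmL ℝ x₀ u = v₀ := T.symmL_continuousLinearMapAt hx₀T v₀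
  have hsu' : T.symmL ℝ x₀ u' = w₀ := T.symmL_continuousLinearMapAt hx₀T w₀
  have h4 : (fun c : EuclideanSpace ℝ (Fin m) ↦ s c v₀ w₀) =
      fun c ↦ ((ContinuousLinearMap.precomp ℝ (T.symmL ℝ x₀)).comp
        ((s c).comp (T.symmL ℝ x₀))) u u' := by
    funext c
    simp only [ContinuousLinearMap.coe_comp, Function.comp_apply,
      ContinuousLinearMap.precomp_apply, hsu, hsu']
  rw [h4]
  exact (h3.clm_apply contDiff_const).clm_apply contDiff_const

/-- The metric component `c ↦ h_{F c}(x₀)(v₀, w₀)` of a jointly smooth family of data, at a fixed point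
and fixed tangent vectors, is a smooth function of the parameter (the first component of
`IsSmoothDataFamily` restricted to the slice `c ↦ (c, x₀)`). -/
private theorem contDiff_h_inner_apply_family {m : ℕ}
    {F : EuclideanSpace ℝ (Fin m) → InitialDataSet (𝓡 3) X} (hF : IsSmoothDataFamily m F)
    (x₀ : X) (v₀ w₀ : TangentSpace (𝓡 3) x₀) :
    ContDiff ℝ ∞ (fun c : EuclideanSpace ℝ (Fin m) ↦ (F c).h.inner x₀ v₀ w₀) :=
  contDiff_bilin_apply_of_contMDiff_family x₀ (s := fun c ↦ (F c).h.inner x₀)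
    (hF.1.comp (contMDiff_id.prodMk contMDiff_const)) v₀ w₀

/-- The extrinsic-curvature component `c ↦ k_{F c}(x₀)(v₀, w₀)` of a jointly smooth family of data, at
a fixed point and fixed tangent vectors, is a smooth function of the parameter (the second component
of `IsSmoothDataFamily` restricted to the slice `c ↦ (c, x₀)`). -/
private theorem contDiff_k_apply_family {m : ℕ}
    {F : EuclideanSpace ℝ (Fin m) → InitialDataSet (𝓡 3) X} (hF : IsSmoothDataFamily m F)
    (x₀ : X) (v₀ w₀ : TangentSpace (𝓡 3) x₀) :
    ContDiff ℝ ∞ (fun c : EuclideanSpace ℝ (Fin m) ↦ (F c).k x₀ v₀ w₀) :=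
  contDiff_bilin_apply_of_contMDiff_family x₀ (s := fun c ↦ (F c).k x₀)
    (hF.2.comp (contMDiff_id.prodMk contMDiff_const)) v₀ w₀

/-- **Window injectivity from one smooth scalar invariant.** If `g : ℝ¹ → ℝ` is smooth with
`dg(0) e₀ ≠ 0` and `g` factors through `F` (`F c = F c' → g c = g c'`), then `F` is injective on a
window `‖c‖ < ε`: `t ↦ g (t e₀)` is strictly monotone for `|t| < δ`
(`RobustClausewiseGenericity.exists_injOn_line_of_fderiv_ne`), and on `ℝ¹` one has `c = c₀ e₀`,
`‖c‖ = |c₀|`. -/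
private theorem exists_window_injOn_of_scalar {α : Type*} (F : EuclideanSpace ℝ (Fin 1) → α)
    {g : EuclideanSpace ℝ (Fin 1) → ℝ} (hg : ContDiff ℝ ∞ g)
    (hg0 : fderiv ℝ g 0 (EuclideanSpace.single (0 : Fin 1) (1 : ℝ)) ≠ 0)
    (hFg : ∀ c c', F c = F c' → g c = g c') :
    ∃ ε > (0 : ℝ), ∀ c c', ‖c‖ < ε → ‖c'‖ < ε → F c = F c' → c = c' := by
  have hg1 : ContDiff ℝ 1 g := hg.of_le (by exact_mod_cast le_top)
  obtain ⟨δ, hδ, hinj⟩ := RobustClausewiseGenericity.exists_injOn_line_of_fderiv_ne hg1 hg0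
  refine ⟨δ, hδ, fun c c' hc hc' hEq ↦ ?_⟩
  -- on `ℝ¹`: `c = c₀ e₀` and `‖c‖ = |c₀|`
  have hce : ∀ c : EuclideanSpace ℝ (Fin 1),
      c 0 • EuclideanSpace.single (0 : Fin 1) (1 : ℝ) = c := fun c ↦ by
    ext i
    fin_cases i
    simp
  have hcn : ∀ c : EuclideanSpace ℝ (Fin 1), ‖c‖ = |c 0| := fun c ↦ by
    rw [EuclideanSpace.norm_eq, Fin.sum_univ_one, Real.norm_eq_abs, sq_abs, Real.sqrt_sq_eq_abs]
  have hgc : g (c 0 • EuclideanSpace.single (0 : Fin 1) (1 : ℝ)) =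
      g (c' 0 • EuclideanSpace.single (0 : Fin 1) (1 : ℝ)) := by
    rw [hce c, hce c']
    exact hFg c c' hEq
  have h00 : c 0 = c' 0 :=
    hinj (c 0) (c' 0) (by rw [← hcn]; exact hc) (by rw [← hcn]; exact hc') hgc
  rw [← hce c, ← hce c', h00]

/-- **A JOINTLY SMOOTH CURVE IMMERSED AT `0` IS INJECTIVE ON A WINDOW** (registered stub
`stub_injOn_of_immersed` of the line `Sketch` of the crux `EIHFluxBalance.ModulatedKerrHandoff`). If
`F : ℝ¹ → data` is jointly smooth and immersed at `0`, then applying immersion to `e₀ ≠ 0` yields a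
scalar component `g c = h_{F c}(x)(u, w)` or `g c = k_{F c}(x)(u, w)` with `dg(0) e₀ ≠ 0`; `g` is smooth
(the family read in the trivialisation of `TX` at `x`, `contDiff_h_inner_apply_family` /
`contDiff_k_apply_family`), hence `t ↦ g (t e₀)` is strictly monotone on a window
(`exists_injOn_line_of_fderiv_ne`), and `F c = F c'` with `‖c‖, ‖c'‖ < ε` forces `c = c'`.
Christodoulou, CQG 16 (1999), p. A24; Lee 2013, Prop. 4.1. -/
theorem stub_injOn_of_immersed :
    ∀ (X : Type) [TopologicalSpace X] [ChartedSpace E3 X] [IsManifold (𝓡 3) ((⊤ : ℕ∞) : WithTop ℕ∞) X] [T2Space X] [SecondCountableTopology X] [ConnectedSpace X],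
      ∀ (F : EuclideanSpace ℝ (Fin 1) → InitialDataSet (𝓡 3) X),
        IsSmoothDataFamily 1 F → IsImmersedAtZero 1 F →
          ∃ ε > (0 : ℝ), ∀ c c', ‖c‖ < ε → ‖c'‖ < ε → F c = F c' → c = c' := by
  intro X _ _ _ _ _ _ F hF hI
  -- the basis vector of `ℝ¹` is non-zero; immersion there gives the witnessing component
  have he₀ : (EuclideanSpace.single (0 : Fin 1) (1 : ℝ) : EuclideanSpace ℝ (Fin 1)) ≠ 0 := by
    rw [← norm_ne_zero_iff, PiLp.norm_single, norm_one]
    exact one_ne_zero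
  obtain ⟨x, u, w, huw⟩ := hI _ he₀
  rcases huw with h | h
  · exact exists_window_injOn_of_scalar F (contDiff_h_inner_apply_family hF x u w) h
      (fun c c' hcc' ↦ by rw [hcc'])
  · exact exists_window_injOn_of_scalar F (contDiff_k_apply_family hF x u w) h
      (fun c c' hcc' ↦ by rw [hcc'])

end Summit.FinalStateConjecture.FinalStateConjecture.Theorems.EIHFluxBalance.TameTemplate

end

-- buildfix 2026-08-20 (ops-buildfix-1 gen 7): enqueue-only re-land — rebuild after B-9 (p218042) healed this module's import closure; no declaration changed.
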